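import Literature.GroupTheory.Index.ChermakDelgadoLattice
import HarnessLib

/-!
# The Chermak–Delgado lattice of a direct product: `CD(G × H) = CD(G) × CD(H)`
# (Brewster–Wilcox 2012, Lemma 1.8 and Theorem 1.9)

Topic `Literature/GroupTheory/Index`, namespace `Literature.GroupTheory.Index` (lane `lit-hodgefound`,
prover p30, generation 49, row g49-#3; sequel of `ChermakDelgadoLattice`).  Theorems only — no
definition, no instance, no notation, no named fact; everything is proved.

## Source, verbatim

B. Brewster, E. Wilcox, *Some groups with computable Chermak–Delgado lattices*, Bull. Aust. Math.
Soc. **86** (2012) 29–40 = arXiv:1202.2385 (held `paper:arxiv-1202.2385`, chunk p0004):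

> "**Lemma 1.8.** Let `G` and `H` be groups. If `U ≤ G × H` then
> `C_{G×H}(U) = C_G(π_G(U)) × C_H(π_H(U))`.
> **Theorem 1.9.** For any finite groups `G` and `H`, the lattices `CD(G × H)` and `CD(G) × CD(H)`
> are equal and `CL(G × H) = CL(G) × CL(H)`.
> *Proof.* Let `U ≤ G × H`. We have the following inequality, with the second step due to Lemma 1.8.
> `m_{G×H}(U) = |U| |C_{G×H}(U)| = |U| |C_G(π_G(U)) × C_H(π_H(U))| ≤ |π_G(U) × π_H(U)| |C_G(π_G(U))
> × C_H(π_H(U))| ≤ |π_G(U)| |C_G(π_G(U))| |π_H(U)| |C_H(π_H(U))| ≤ m_G(π_G(U)) m_H(π_H(U))`.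
> Equality occurs exactly when `U = π_G(U) × π_H(U)`. Therefore, the subgroups of `G × H` with
> maximal measure are exactly those direct products `X × Y` where `X ∈ CD(G)` and `Y ∈ CD(H)`. This
> gives `CD(G × H) = CD(G) × CD(H)`. […]"

Dictionary: `π_G(U) = U.map (MonoidHom.fst G H)`, `π_H(U) = U.map (MonoidHom.snd G H)`,
`X × Y = X.prod Y`; `CD`, `m` are `chermakDelgadoLattice`, `chermakDelgadoMeasure` of the tree file
`ChermakDelgadoLattice`.  The `CL` (centrally large) half of Theorem 1.9 is not formalized here
(`-- TODO(CL): Glauberman's centrally large subgroups are not in the tree`).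

## References

* [BrewsterWilcox2012] B. Brewster, E. Wilcox, *Some groups with computable Chermak–Delgado
  lattices*, Bull. Aust. Math. Soc. 86 (2012) 29–40, arXiv:1202.2385; Lemma 1.8, Theorem 1.9.
-/

namespace Literature.GroupTheory.Index

variable {G H : Type*} [Group G] [Group H]

/-- **Lemma 1.8: `C_{G×H}(U) = C_G(π_G(U)) × C_H(π_H(U))`.** [cite: BrewsterWilcox2012, Lemma 1.8] -/
theorem centralizer_eq_prod_centralizer_map (U : Subgroup (G × H)) :
    Subgroup.centralizer (U : Set (G × H)) =
      (Subgroup.centralizer ((U.map (MonoidHom.fst G H) : Subgroup G) : Set G)).prod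
        (Subgroup.centralizer ((U.map (MonoidHom.snd G H) : Subgroup H) : Set H)) := by
  ext ⟨g, h⟩
  rw [Subgroup.mem_prod, Subgroup.mem_centralizer_iff, Subgroup.mem_centralizer_iff,
    Subgroup.mem_centralizer_iff]
  constructor
  · intro hc
    constructor
    · rintro - ⟨⟨u, v⟩, huv, rfl⟩
      exact congrArg Prod.fst (hc (u, v) huv)
    · rintro - ⟨⟨u, v⟩, huv, rfl⟩
      exact congrArg Prod.snd (hc (u, v) huv)
  · rintro ⟨h1, h2⟩ ⟨u, v⟩ huv
    exact Prod.ext (h1 u ⟨(u, v), huv, rfl⟩) (h2 v ⟨(u, v), huv, rfl⟩)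

/-- `|X × Y| = |X| · |Y|` for subgroups. [folklore] -/
private theorem card_prod (X : Subgroup G) (Y : Subgroup H) :
    Nat.card (X.prod Y) = Nat.card X * Nat.card Y := by
  rw [Nat.card_congr (Subgroup.prodEquiv X Y).toEquiv, Nat.card_prod]

/-- `U ≤ π_G(U) × π_H(U)`. [folklore] -/
private theorem le_prod_map (U : Subgroup (G × H)) :
    U ≤ (U.map (MonoidHom.fst G H)).prod (U.map (MonoidHom.snd G H)) :=
  Subgroup.le_prod_iff.mpr ⟨le_rfl, le_rfl⟩

/-- `π_G(X × Y) = X` and `π_H(X × Y) = Y`. [folklore] -/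
private theorem map_fst_prod (X : Subgroup G) (Y : Subgroup H) :
    (X.prod Y).map (MonoidHom.fst G H) = X := by
  ext g
  constructor
  · rintro ⟨⟨a, b⟩, hab, rfl⟩
    exact (Subgroup.mem_prod.mp hab).1
  · intro hg
    exact ⟨(g, 1), Subgroup.mem_prod.mpr ⟨hg, Y.one_mem⟩, rfl⟩

/-- `π_H(X × Y) = Y`. [folklore] -/
private theorem map_snd_prod (X : Subgroup G) (Y : Subgroup H) :
    (X.prod Y).map (MonoidHom.snd G H) = Y := by
  ext h
  constructor
  · rintro ⟨⟨a, b⟩, hab, rfl⟩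
    exact (Subgroup.mem_prod.mp hab).2
  · intro hh
    exact ⟨(1, h), Subgroup.mem_prod.mpr ⟨X.one_mem, hh⟩, rfl⟩

/-- **`m_{G×H}(X × Y) = m_G(X) · m_H(Y)`.** [cite: BrewsterWilcox2012, Theorem 1.9 (proof)] -/
theorem chermakDelgadoMeasure_prod (X : Subgroup G) (Y : Subgroup H) :
    chermakDelgadoMeasure (X.prod Y) = chermakDelgadoMeasure X * chermakDelgadoMeasure Y := by
  rw [chermakDelgadoMeasure, chermakDelgadoMeasure, chermakDelgadoMeasure,
    centralizer_eq_prod_centralizer_map, map_fst_prod, map_snd_prod, card_prod, card_prod]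
  ring

/-- **`m_{G×H}(U) ≤ m_G(π_G(U)) · m_H(π_H(U))`.** [cite: BrewsterWilcox2012, Theorem 1.9 (proof)] -/
theorem chermakDelgadoMeasure_le_measure_map_mul [Finite G] [Finite H] (U : Subgroup (G × H)) :
    chermakDelgadoMeasure U ≤
      chermakDelgadoMeasure (U.map (MonoidHom.fst G H)) * chermakDelgadoMeasure (U.map (MonoidHom.snd G H)) := by
  rw [← chermakDelgadoMeasure_prod, chermakDelgadoMeasure, chermakDelgadoMeasure,
    centralizer_eq_prod_centralizer_map U,
    centralizer_eq_prod_centralizer_map ((U.map (MonoidHom.fst G H)).prod (U.map (MonoidHom.snd G H))),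
    map_fst_prod, map_snd_prod]
  exact Nat.mul_le_mul_right _ (Subgroup.card_le_of_le (le_prod_map U))

/-- **"Equality occurs exactly when `U = π_G(U) × π_H(U)`."** [cite: BrewsterWilcox2012, Theorem 1.9 (proof)] -/
theorem chermakDelgadoMeasure_eq_measure_map_mul_iff [Finite G] [Finite H] (U : Subgroup (G × H)) :
    chermakDelgadoMeasure U =
      chermakDelgadoMeasure (U.map (MonoidHom.fst G H)) * chermakDelgadoMeasure (U.map (MonoidHom.snd G H)) ↔
      U = (U.map (MonoidHom.fst G H)).prod (U.map (MonoidHom.snd G H)) := by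
  rw [← chermakDelgadoMeasure_prod]
  constructor
  · intro h
    rw [chermakDelgadoMeasure, chermakDelgadoMeasure, centralizer_eq_prod_centralizer_map U,
      centralizer_eq_prod_centralizer_map ((U.map (MonoidHom.fst G H)).prod (U.map (MonoidHom.snd G H))),
      map_fst_prod, map_snd_prod] at h
    have hc := Nat.eq_of_mul_eq_mul_right Nat.card_pos h
    exact Subgroup.eq_of_le_of_card_ge (le_prod_map U) hc.ge
  · intro h
    rw [← h]

/-- **Theorem 1.9 (products of members): `X × Y ∈ CD(G × H) ↔ X ∈ CD(G) ∧ Y ∈ CD(H)`.**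
[cite: BrewsterWilcox2012, Theorem 1.9] -/
theorem prod_mem_chermakDelgadoLattice_iff [Finite G] [Finite H] (X : Subgroup G) (Y : Subgroup H) :
    X.prod Y ∈ chermakDelgadoLattice (G × H) ↔
      X ∈ chermakDelgadoLattice G ∧ Y ∈ chermakDelgadoLattice H := by
  constructor
  · intro h
    constructor
    · intro K
      have h1 := h (K.prod Y)
      rw [chermakDelgadoMeasure_prod, chermakDelgadoMeasure_prod] at h1
      exact Nat.le_of_mul_le_mul_right h1 (chermakDelgadoMeasure_pos Y)
    · intro K
      have h1 := h (X.prod K)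
      rw [chermakDelgadoMeasure_prod, chermakDelgadoMeasure_prod] at h1
      exact Nat.le_of_mul_le_mul_left h1 (chermakDelgadoMeasure_pos X)
  · rintro ⟨hX, hY⟩ U
    calc chermakDelgadoMeasure U
        ≤ chermakDelgadoMeasure (U.map (MonoidHom.fst G H)) *
            chermakDelgadoMeasure (U.map (MonoidHom.snd G H)) := chermakDelgadoMeasure_le_measure_map_mul U
      _ ≤ chermakDelgadoMeasure X * chermakDelgadoMeasure Y := Nat.mul_le_mul (hX _) (hY _)
      _ = chermakDelgadoMeasure (X.prod Y) := (chermakDelgadoMeasure_prod X Y).symm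

/-- **Theorem 1.9: "the subgroups of `G × H` with maximal measure are exactly those direct products
`X × Y` where `X ∈ CD(G)` and `Y ∈ CD(H)`" — `CD(G × H) = CD(G) × CD(H)`.**
[cite: BrewsterWilcox2012, Theorem 1.9] -/
theorem mem_chermakDelgadoLattice_prod_iff [Finite G] [Finite H] (U : Subgroup (G × H)) :
    U ∈ chermakDelgadoLattice (G × H) ↔
      ∃ X ∈ chermakDelgadoLattice G, ∃ Y ∈ chermakDelgadoLattice H, U = X.prod Y := by
  constructor
  · intro hU
    -- compare with a product of maximal members: `m(U) = ℳ_G ℳ_H` forces equality everywhere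
    obtain ⟨X₀, hX₀⟩ := chermakDelgadoLattice_nonempty (G := G)
    obtain ⟨Y₀, hY₀⟩ := chermakDelgadoLattice_nonempty (G := H)
    have hprod := (prod_mem_chermakDelgadoLattice_iff X₀ Y₀).mpr ⟨hX₀, hY₀⟩
    have heq := measure_eq_of_mem_of_mem hU hprod
    rw [chermakDelgadoMeasure_prod] at heq
    have h1 := chermakDelgadoMeasure_le_measure_map_mul U
    have h2 : chermakDelgadoMeasure (U.map (MonoidHom.fst G H)) ≤ chermakDelgadoMeasure X₀ := hX₀ _
    have h3 : chermakDelgadoMeasure (U.map (MonoidHom.snd G H)) ≤ chermakDelgadoMeasure Y₀ := hY₀ _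
    have hpos1 := chermakDelgadoMeasure_pos X₀
    have hpos3 := chermakDelgadoMeasure_pos (U.map (MonoidHom.snd G H))
    -- `m(π_G U) = m(X₀)` and `m(π_H U) = m(Y₀)`
    have e2 : chermakDelgadoMeasure (U.map (MonoidHom.fst G H)) = chermakDelgadoMeasure X₀ := by
      by_contra hne
      have hlt := lt_of_le_of_ne h2 hne
      have := Nat.mul_lt_mul_of_lt_of_le' hlt h3 hpos3
      omega
    have e3 : chermakDelgadoMeasure (U.map (MonoidHom.snd G H)) = chermakDelgadoMeasure Y₀ := by
      by_contra hne
      have hlt := lt_of_le_of_ne h3 hne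
      have := Nat.mul_lt_mul_of_le_of_lt h2 hlt hpos1
      omega
    have e1 : chermakDelgadoMeasure U = chermakDelgadoMeasure (U.map (MonoidHom.fst G H)) *
        chermakDelgadoMeasure (U.map (MonoidHom.snd G H)) := by
      rw [e2, e3]; exact heq
    refine ⟨U.map (MonoidHom.fst G H), mem_of_measure_eq hX₀ e2, U.map (MonoidHom.snd G H),
      mem_of_measure_eq hY₀ e3, ?_⟩
    exact (chermakDelgadoMeasure_eq_measure_map_mul_iff U).mp e1
  · rintro ⟨X, hX, Y, hY, rfl⟩
    exact (prod_mem_chermakDelgadoLattice_iff X Y).mpr ⟨hX, hY⟩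

/-- The maximal measure of `G × H` is the product of the maximal measures: for `U ∈ CD(G × H)`,
`X ∈ CD(G)`, `Y ∈ CD(H)`, `m(U) = m(X) m(Y)`. [cite: BrewsterWilcox2012, Theorem 1.9 (proof)] -/
theorem measure_eq_mul_of_mem [Finite G] [Finite H] {U : Subgroup (G × H)} {X : Subgroup G}
    {Y : Subgroup H} (hU : U ∈ chermakDelgadoLattice (G × H)) (hX : X ∈ chermakDelgadoLattice G)
    (hY : Y ∈ chermakDelgadoLattice H) :
    chermakDelgadoMeasure U = chermakDelgadoMeasure X * chermakDelgadoMeasure Y := by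
  rw [← chermakDelgadoMeasure_prod]
  exact measure_eq_of_mem_of_mem hU ((prod_mem_chermakDelgadoLattice_iff X Y).mpr ⟨hX, hY⟩)

/-- **The Chermak–Delgado subgroup of a direct product: `m(G × H) = m(G) × m(H)`.**
[cite: BrewsterWilcox2012, Theorem 1.9] -/
theorem chermakDelgadoSubgroup_prod [Finite G] [Finite H] :
    chermakDelgadoSubgroup (G × H) = (chermakDelgadoSubgroup G).prod (chermakDelgadoSubgroup H) := by
  apply le_antisymm
  · exact chermakDelgadoSubgroup_le ((prod_mem_chermakDelgadoLattice_iff _ _).mpr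
      ⟨chermakDelgadoSubgroup_mem, chermakDelgadoSubgroup_mem⟩)
  · obtain ⟨X, hX, Y, hY, hXY⟩ :=
      (mem_chermakDelgadoLattice_prod_iff _).mp (chermakDelgadoSubgroup_mem (G := G × H))
    rw [hXY]
    exact Subgroup.prod_mono (chermakDelgadoSubgroup_le hX) (chermakDelgadoSubgroup_le hY)

-- TODO(CL): the `CL(G × H) = CL(G) × CL(H)` half of Theorem 1.9 needs Glauberman's centrally large
-- subgroups, not yet in the tree.

end Literature.GroupTheory.Index
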